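import Literature.Geometry.Kaehler.HodgeRiemannPointwiseDecomposition
import HarnessLib

/-!
# Pointwise Hodge–Riemann, III: the bilinear relation on a unitary frame, by induction on the frame

Topic `Literature/Geometry/Kaehler`. Third file of the pointwise Hodge–Riemann bilinear relation
(D. Huybrechts, *Complex Geometry* (2005), Cor. 1.2.36: on a Hermitian vector space of dimension
`d`, for a non-zero primitive form `a` of type `(p,q)`, `k = p + q ≤ d`,
`i^{p-q} (-1)^{k(k-1)/2} a ∧ ā ∧ ω^{d-k} = c · ω^d` with `c > 0`; C. Voisin, *Hodge Theory and
Complex Algebraic Geometry I* (2002), §6.3.2, the pointwise content of Thm. 6.32). In the graded-form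
calculus of a unitary frame `(uₐ, Juₐ)` (files I–II) we prove it for the PARTIAL Kähler forms
`ω_S = ∑_{a ∈ S} θₐ ∧ θ'ₐ` and forms supported in `S ⊆ Fin d`, by induction on `S`
(`hodgeRiemann_frame_induction`): for `α` homogeneous of degree `k`, supported in `S`, of weight
`w` (type `(p,q)` with `p - q = w`) and primitive (`L_S^{r+1} α = 0`, `k + r = |S|`),

  `i^w (-1)^{k(k-1)/2} L_S^r (α ∧ ᾱ) = c · L_S^{|S|} 1`,  `c ≥ 0`, and `c > 0` if `α ≠ 0`.

The induction step splits off the complex line of `u_n` (file II: `α = a + ζ ∧ b + ζ̄ ∧ c + θθ' ∧ d`,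
`a₀ = a + (r+1)⁻¹ L' d`; all four are primitive in one dimension less, of types
`(p,q), (p-1,q), (p,q-1), (p-1,q-1)`) and rests on the identity (`lef_pow_wedgeG_conjG_decomposition`)

  `L^r (α ∧ ᾱ) = L^r (a₀ ∧ ā₀) + θθ' ∧ { (-1)^{k-1}(-2i) L'^r (b ∧ b̄) + (-1)^{k-1}(2i) L'^r (c ∧ c̄)
     + (ε²r - 2ε) L'^{r+1} (d ∧ d̄) }`,   `ε = (r+1)⁻¹`,

in which — after multiplication by `i^w (-1)^{k(k-1)/2}` — every term is a NON-NEGATIVE multiple of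
`θθ' ∧ L'^{|S'|} 1 = L_S^{|S|} 1 / |S|` by the induction hypothesis (the sign bookkeeping
`ε_{k+1} ε_k = (-1)^k`, `ε_{k+2} ε_k = -1` for `ε_k = (-1)^{k(k-1)/2}`). The case `S = univ` is the
pointwise Hodge–Riemann relation in CAR form (`hodgeRiemann_frame`); its translation to the tree's
`kaehlerFormPow` / `MForm` language is file IV.

Everything is a theorem (no definitions, no named facts).

## References

* D. Huybrechts, *Complex Geometry. An Introduction* (2005), Prop. 1.2.30, Cor. 1.2.36 (p. 53).
  [Huybrechts2005]
* C. Voisin, *Hodge Theory and Complex Algebraic Geometry I*, CUP (2002), §6.2.1 Lemma 6.20, §6.3.2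
  Thm. 6.32. [Voisin2002]
-/

noncomputable section

open Module Submodule ContinuousAlternatingMap Function Finset
open scoped InnerProductSpace
open Literature.LinearAlgebra.Alternating Literature.LinearAlgebra.Alternating.GForm

namespace Literature.Geometry.Kaehler

section HodgeRiemann

variable {V : Type*} [NormedAddCommGroup V] [InnerProductSpace ℝ V]
  (J : V →L[ℝ] V) (hJJ : ∀ v, J (J v) = -v) (hJ : ∀ v w, ⟪J v, J w⟫_ℝ = ⟪v, w⟫_ℝ)
  {d : ℕ} (u : Fin d → V) (hu : Orthonormal ℝ u) (huJ : ∀ i j, ⟪u i, J (u j)⟫_ℝ = 0)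

/-! ### Signs -/

/-- `(-1)^{k(k-1)/2} = (-1)^{0 + 1 + ⋯ + (k-1)}`. [folklore] -/
theorem neg_one_pow_half_eq_sum (k : ℕ) :
    ((-1 : ℂ) ^ (k * (k - 1) / 2)) = (-1 : ℂ) ^ (∑ i ∈ range k, i) := by
  rw [Finset.sum_range_id]

/-- `ε_{k+1} ε_k = (-1)^k` for `ε_k = (-1)^{k(k-1)/2}`. [folklore] -/
theorem neg_one_pow_half_succ_mul (k : ℕ) :
    (-1 : ℂ) ^ ((k + 1) * (k + 1 - 1) / 2) * (-1 : ℂ) ^ (k * (k - 1) / 2) = (-1) ^ k := by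
  rw [neg_one_pow_half_eq_sum, neg_one_pow_half_eq_sum, Finset.sum_range_succ, ← pow_add,
    show ∑ i ∈ range k, i + k + ∑ i ∈ range k, i = 2 * (∑ i ∈ range k, i) + k by ring, pow_add, pow_mul,
    neg_one_sq, one_pow, one_mul]

/-- `ε_{k+2} ε_k = -1`. [folklore] -/
theorem neg_one_pow_half_succ_succ_mul (k : ℕ) :
    (-1 : ℂ) ^ ((k + 2) * (k + 2 - 1) / 2) * (-1 : ℂ) ^ (k * (k - 1) / 2) = -1 := by
  rw [neg_one_pow_half_eq_sum, neg_one_pow_half_eq_sum, Finset.sum_range_succ, Finset.sum_range_succ, ← pow_add,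
    show ∑ i ∈ range k, i + k + (k + 1) + ∑ i ∈ range k, i = 2 * (∑ i ∈ range k, i + k) + 1 by ring, pow_add,
    pow_mul, neg_one_sq, one_pow, one_mul, pow_one]

/-! ### The parity operator and the Lefschetz-type operators -/

omit [InnerProductSpace ℝ V] in
/-- `negDeg 0 = 0`. [folklore] -/
theorem negDeg_zero [NormedSpace ℝ V] {F : Type*} [NormedAddCommGroup F] [NormedSpace ℝ F] :
    negDeg (0 : GForm V F) = 0 := by
  funext m; rw [negDeg_apply, Pi.zero_apply, smul_zero]

omit [InnerProductSpace ℝ V] in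
/-- The Lefschetz-type operators (even degree shift) commute with the parity operator. [folklore] -/
theorem lefG_negDeg [NormedSpace ℝ V] {F : Type*} [NormedAddCommGroup F] [NormedSpace ℝ F] {ι : Type*}
    (θ θ' : ι → V →L[ℝ] ℝ) (s : Finset ι) (w : GForm V F) : lefG θ θ' s (negDeg w) = negDeg (lefG θ θ' s w) := by
  funext m
  match m with
  | 0 => rw [lefG_apply_zero, negDeg_apply, lefG_apply_zero, smul_zero]
  | 1 => rw [lefG_apply_one, negDeg_apply, lefG_apply_one, smul_zero]
  | m + 2 =>
    rw [lefG_apply_add_two, negDeg_apply, negDeg_apply, lefG_apply_add_two, Finset.smul_sum]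
    refine Finset.sum_congr rfl fun a _ ↦ ?_
    rw [wedgeOne_smul, wedgeOne_smul, pow_add, neg_one_sq, mul_one]

omit [InnerProductSpace ℝ V] in
/-- The powers of the Lefschetz-type operators commute with the parity operator. [folklore] -/
theorem lefG_pow_negDeg [NormedSpace ℝ V] {F : Type*} [NormedAddCommGroup F] [NormedSpace ℝ F] {ι : Type*}
    (θ θ' : ι → V →L[ℝ] ℝ) (s : Finset ι) (r : ℕ) (w : GForm V F) :
    (lefG θ θ' s ^ r) (negDeg w) = negDeg ((lefG θ θ' s ^ r) w) := by
  induction r generalizing w with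
  | zero => rfl
  | succ r ih => rw [pow_succ, Module.End.mul_apply, Module.End.mul_apply, lefG_negDeg, ih]

/-! ### Degree zero -/

/-- A `0`-form is the constant `0`-form on its value. [folklore] -/
theorem eq_constOfIsEmpty_zero {F : Type*} [NormedAddCommGroup F] [NormedSpace ℝ F]
    (η : V [⋀^Fin 0]→L[ℝ] F) : η = constOfIsEmpty ℝ V (Fin 0) (η ![]) := by
  ext v
  rw [constOfIsEmpty_apply, Subsingleton.elim v ![]]

/-- A constant `0`-form is a multiple of the unit `0`-form. [folklore] -/
theorem constOfIsEmpty_eq_smul_one (a : ℂ) :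
    constOfIsEmpty ℝ V (Fin 0) a = a • constOfIsEmpty ℝ V (Fin 0) (1 : ℂ) := by
  ext v; simp

/-- The wedge of two constant `0`-forms. [folklore] -/
theorem constOfIsEmpty_wedge_constOfIsEmpty (a b : ℂ) :
    (constOfIsEmpty ℝ V (Fin 0) a).wedge (constOfIsEmpty ℝ V (Fin 0) b) =
      (constOfIsEmpty ℝ V (Fin 0) (a * b)).domDomCongr (finCongr (Nat.zero_add 0).symm) := by
  rw [constOfIsEmpty_eq_smul_one a, wedge_smul_left_complex, ContinuousAlternatingMap.constOfIsEmpty_one_wedge,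
    constOfIsEmpty_eq_smul_one b, constOfIsEmpty_eq_smul_one (a * b), domDomCongr_finCongr_smul,
    domDomCongr_finCongr_smul, smul_smul]

/-- The conjugate of a constant `0`-form. [folklore] -/
theorem conjForm_constOfIsEmpty (a : ℂ) :
    conjForm (constOfIsEmpty ℝ V (Fin 0) a) = constOfIsEmpty ℝ V (Fin 0) (starRingEnd ℂ a) := by
  ext v; simp [conjForm_apply]

/-- **Degree zero**: for `α` homogeneous of degree `0`,
`α ∧ ᾱ = ‖α₀‖² · 1` with `α₀` the constant value of `α`. [folklore] -/
theorem wedgeG_conjG_of_isHomog_zero {α : GForm V ℂ} (h : IsHomog 0 α) :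
    wedgeG α (conjG α) = ((Complex.normSq (α 0 ![]) : ℝ) : ℂ) • of 0 (constOfIsEmpty ℝ V (Fin 0) (1 : ℂ)) := by
  conv_lhs => rw [h.eq_of, eq_constOfIsEmpty_zero (α 0), conjG_of, conjForm_constOfIsEmpty, wedgeG_of_of,
    constOfIsEmpty_wedge_constOfIsEmpty, of_domDomCongr_finCongr, Complex.mul_conj, constOfIsEmpty_eq_smul_one,
    of_smul]

/-- A graded form homogeneous of degree `0` vanishes iff its constant value does. [folklore] -/
theorem eq_zero_iff_of_isHomog_zero {α : GForm V ℂ} (h : IsHomog 0 α) : α = 0 ↔ α 0 ![] = 0 := by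
  rw [h.eq_zero_iff]
  constructor
  · intro h0; rw [h0]; rfl
  · intro h0
    rw [eq_constOfIsEmpty_zero (α 0), h0]
    ext v; simp

/-- **The Hodge–Riemann relation in degree `0`** (no primitivity, no frame): for `α` homogeneous of
degree `0` and of some weight `w`, `i^w L^r (α ∧ ᾱ) = c · L^r 1` with `c = ‖α₀‖² ≥ 0`, positive iff
`α ≠ 0` (a non-zero `0`-form has weight `0`). [cite: Huybrechts2005, Cor. 1.2.36] -/
theorem hodgeRiemann_degree_zero {ι : Type*} (θ θ' : ι → V →L[ℝ] ℝ) (s : Finset ι) (r : ℕ) {w : ℤ}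
    {α : GForm V ℂ} (h : IsHomog 0 α) (hw : HasRotWeight J w α) :
    ∃ c : ℝ, 0 ≤ c ∧ (α ≠ 0 → 0 < c) ∧
      (Complex.I ^ w * (-1 : ℂ) ^ (0 * (0 - 1) / 2)) • (lefG θ θ' s ^ r) (wedgeG α (conjG α)) =
        (c : ℂ) • (lefG θ θ' s ^ r) (of 0 (constOfIsEmpty ℝ V (Fin 0) (1 : ℂ))) := by
  by_cases hα : α = 0
  · refine ⟨0, le_rfl, fun h' ↦ absurd hα h', ?_⟩
    rw [hα, wedgeG_zero_left, LinearMap.map_zero, smul_zero, Complex.ofReal_zero, zero_smul]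
  · have hw0 : w = 0 := by
      by_contra hne
      exact hα (hw.eq_zero_of_isHomog_zero h hne)
    refine ⟨Complex.normSq (α 0 ![]), Complex.normSq_nonneg _, fun _ ↦ ?_, ?_⟩
    · exact Complex.normSq_pos.2 fun h0 ↦ hα ((eq_zero_iff_of_isHomog_zero h).2 h0)
    · rw [hw0, zpow_zero, one_mul, Nat.zero_mul, Nat.zero_div, pow_zero, one_smul,
        wedgeG_conjG_of_isHomog_zero h, lefG_pow_smul_complex]

/-! ### The operator identities for `L = L' + L_{n}` -/

section Operators

variable {J u} {S' : Finset (Fin d)} {n : Fin d} (hn : n ∉ S')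
include hn

/-- `L_{insert n S'} = L_{n} + L_{S'}`. [folklore] -/
theorem frameLef_insert : (frameLef J u (insert n S') : Module.End ℝ (GForm V ℂ)) = frameLef J u {n} + frameLef J u S' := by
  classical
  exact lefG_insert _ _ hn

/-- **(O1)** `L^r L_{n} = L_{n} L'^r` for `L = L_{insert n S'}`, `L' = L_{S'}` (`L_{n}² = 0`).
[cite: Huybrechts2005, Prop. 1.2.30] -/
theorem frameLef_insert_pow_frameLef_singleton (r : ℕ) (w : GForm V ℂ) :
    (frameLef J u (insert n S') ^ r) (frameLef J u {n} w) = frameLef J u {n} ((frameLef J u S' ^ r) w) := by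
  induction r generalizing w with
  | zero => rfl
  | succ r ih =>
    have e1 : frameLef J u S' (frameLef J u {n} w) = frameLef J u {n} (frameLef J u S' w) := by
      have := frameLef_pow_frameLef (F := ℂ) (J := J) (u := u) S' {n} 1 w
      rwa [pow_one] at this
    have e2 : frameLef J u (insert n S') (frameLef J u {n} w) = frameLef J u {n} (frameLef J u S' w) := by
      rw [frameLef_insert hn, LinearMap.add_apply, frameLef_singleton_frameLef_singleton, zero_add, e1]
    rw [pow_succ, Module.End.mul_apply, e2, ih, ← Module.End.mul_apply (frameLef J u S' ^ r), ← pow_succ]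

/-- **(O2)** `L^r (ξ ∧ w) = ξ ∧ L'^r w` for `ξ ∈ {θ_{u_n}, θ_{Ju_n}}`: the version for `θ_{u_n}`.
[cite: Huybrechts2005, Prop. 1.2.30] -/
theorem frameLef_insert_pow_wedgeOneG_u (r : ℕ) (w : GForm V ℂ) :
    (frameLef J u (insert n S') ^ r) (wedgeOneG (innerSL ℝ (u n)) w) =
      wedgeOneG (innerSL ℝ (u n)) ((frameLef J u S' ^ r) w) := by
  induction r generalizing w with
  | zero => rfl
  | succ r ih =>
    have e2 : frameLef J u (insert n S') (wedgeOneG (innerSL ℝ (u n)) w) =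
        wedgeOneG (innerSL ℝ (u n)) (frameLef J u S' w) := by
      rw [frameLef_insert hn, LinearMap.add_apply]
      change lefG _ _ {n} _ + lefG _ _ S' _ = _
      rw [lefG_singleton_wedgeOneG_fst, zero_add, lefG_wedgeOneG]; rfl
    rw [pow_succ, Module.End.mul_apply, e2, ih, ← Module.End.mul_apply (frameLef J u S' ^ r), ← pow_succ]

/-- **(O2')** the version for `θ_{Ju_n}`. [cite: Huybrechts2005, Prop. 1.2.30] -/
theorem frameLef_insert_pow_wedgeOneG_Ju (r : ℕ) (w : GForm V ℂ) :
    (frameLef J u (insert n S') ^ r) (wedgeOneG (innerSL ℝ (J (u n))) w) =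
      wedgeOneG (innerSL ℝ (J (u n))) ((frameLef J u S' ^ r) w) := by
  induction r generalizing w with
  | zero => rfl
  | succ r ih =>
    have e2 : frameLef J u (insert n S') (wedgeOneG (innerSL ℝ (J (u n))) w) =
        wedgeOneG (innerSL ℝ (J (u n))) (frameLef J u S' w) := by
      rw [frameLef_insert hn, LinearMap.add_apply]
      change lefG _ _ {n} _ + lefG _ _ S' _ = _
      rw [lefG_singleton_wedgeOneG_snd, zero_add, lefG_wedgeOneG]; rfl
    rw [pow_succ, Module.End.mul_apply, e2, ih, ← Module.End.mul_apply (frameLef J u S' ^ r), ← pow_succ]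

/-- `L^r (ζ ∧ w) = ζ ∧ L'^r w`. [cite: Huybrechts2005, Prop. 1.2.30] -/
theorem frameLef_insert_pow_zetaWedgeG (r : ℕ) (w : GForm V ℂ) :
    (frameLef J u (insert n S') ^ r) (zetaWedgeG J (u n) w) = zetaWedgeG J (u n) ((frameLef J u S' ^ r) w) := by
  rw [zetaWedgeG_def, zetaWedgeG_def, map_add, frameLef_pow_smul_complex, frameLef_insert_pow_wedgeOneG_u hn,
    frameLef_insert_pow_wedgeOneG_Ju hn]

/-- `L^r (ζ̄ ∧ w) = ζ̄ ∧ L'^r w`. [cite: Huybrechts2005, Prop. 1.2.30] -/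
theorem frameLef_insert_pow_zetaBarWedgeG (r : ℕ) (w : GForm V ℂ) :
    (frameLef J u (insert n S') ^ r) (zetaBarWedgeG J (u n) w) =
      zetaBarWedgeG J (u n) ((frameLef J u S' ^ r) w) := by
  rw [zetaBarWedgeG_def, zetaBarWedgeG_def, map_sub, frameLef_pow_smul_complex, frameLef_insert_pow_wedgeOneG_u hn,
    frameLef_insert_pow_wedgeOneG_Ju hn]

/-- **(O3)** `L^r L' = L'^{r+1} + r L_{n} L'^r`. [cite: Huybrechts2005, Prop. 1.2.30] -/
theorem frameLef_insert_pow_frameLef (r : ℕ) (w : GForm V ℂ) :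
    (frameLef J u (insert n S') ^ r) (frameLef J u S' w) =
      (frameLef J u S' ^ (r + 1)) w + r • frameLef J u {n} ((frameLef J u S' ^ r) w) := by
  classical
  cases r with
  | zero => rw [zero_smul, add_zero, pow_one]; rfl
  | succ r =>
    have h := lefG_insert_pow_succ (F := ℂ) (fun a ↦ innerSL ℝ (u a)) (fun a ↦ innerSL ℝ (J (u a))) hn r
    change (lefG _ _ (insert n S') ^ (r + 1)) _ = _
    rw [h, LinearMap.add_apply, LinearMap.smul_apply, Module.End.mul_apply]
    change (frameLef J u S' ^ (r + 1)) (frameLef J u S' w) + (r + 1) • frameLef J u {n}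
      ((frameLef J u S' ^ r) (frameLef J u S' w)) = _
    rw [← Module.End.mul_apply, ← pow_succ, ← Module.End.mul_apply (frameLef J u S' ^ r), ← pow_succ]

end Operators

/-! ### Weights and the Lefschetz operators -/

include hJJ hJ in
/-- **`L_T` preserves weights** (`θₐ ∧ θ'ₐ ∧ · = (i/2) ζₐ ∧ ζ̄ₐ ∧ ·` has weight `0`).
[cite: Voisin2002, §6.2.1] -/
theorem HasRotWeight.frameLef {w : ℤ} {α : GForm V ℂ} (h : HasRotWeight J w α) (T : Finset (Fin d)) :
    HasRotWeight J w (frameLef J u T α) := by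
  rw [Literature.Geometry.Kaehler.frameLef, lefG_apply]
  refine HasRotWeight.sum T fun a _ ↦ ?_
  rw [wedgeOneG_wedgeOneG_eq_zeta]
  have h1 := ((h.zetaBar_wedge hJJ hJ (u a)).zeta_wedge hJJ hJ (u a)).smul (2⁻¹ * Complex.I)
  rw [sub_add_cancel] at h1
  exact h1

include hJJ hJ in
/-- `L_T^r` preserves weights. [cite: Voisin2002, §6.2.1] -/
theorem HasRotWeight.frameLef_pow {w : ℤ} {α : GForm V ℂ} (h : HasRotWeight J w α) (T : Finset (Fin d)) (r : ℕ) :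
    HasRotWeight J w ((Literature.Geometry.Kaehler.frameLef J u T ^ r) α) := by
  induction r with
  | zero => exact h
  | succ r ih =>
    rw [pow_succ', Module.End.mul_apply]
    exact HasRotWeight.frameLef J hJJ hJ u ih T

/-! ### The main identity -/

section Identity

variable {J u} {S' : Finset (Fin d)} {n : Fin d} (hn : n ∉ S')
include hn

set_option maxHeartbeats 1600000 in
/-- **The Hodge–Riemann recursion identity.** Let `S = insert n S'` (`n ∉ S'`), `L = L_S`, `L' = L_{S'}`,
`L_{n} = θθ' ∧ ·` for `θ = θ_{u_n}`, `θ' = θ_{Ju_n}`, `ζ = θ + iθ'`. For graded forms `A₀, B, C, D`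
with `B, C` homogeneous of degree `k₁` and the primitivity conditions `L'^r A₀ = 0`,
`L'^{r+1} B = 0`, `L'^{r+1} C = 0`, `L'^{r+2} D = 0`, and any real `ε`, the form
`α' = A₀ + ζ ∧ B + ζ̄ ∧ C + L_{n} D - ε L' D` satisfies

  `L^r (α' ∧ ᾱ') = L^r (A₀ ∧ Ā₀) + L_{n} { (-1)^{k₁}(-2i) L'^r (B ∧ B̄) + (-1)^{k₁}(2i) L'^r (C ∧ C̄)
     + (ε² r - 2ε) L'^{r+1} (D ∧ D̄) }`

(the cross terms die by primitivity, `ζ ∧ ζ = 0`, `L_{n} ζ = 0`, `L_{n}² = 0`; the `B`- and `C`-terms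
come from `ζ ∧ ζ̄ = -2i θθ'`, the `D`-term from `(L_{n} D - εL'D) ∧ (L_{n} D̄ - εL'D̄)` and
`L^r L' = L'^{r+1} + r L_{n} L'^r`). [cite: Huybrechts2005, Cor. 1.2.36] -/
theorem lef_pow_wedgeG_conjG_decomposition {k₁ r : ℕ} {A₀ B C D : GForm V ℂ}
    (hBh : IsHomog k₁ B) (hCh : IsHomog k₁ C)
    (hA0 : (frameLef J u S' ^ r) A₀ = 0) (hB : (frameLef J u S' ^ (r + 1)) B = 0)
    (hC : (frameLef J u S' ^ (r + 1)) C = 0) (hD : (frameLef J u S' ^ (r + 2)) D = 0) (ε : ℝ) :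
    (frameLef J u (insert n S') ^ r) (wedgeG
        (A₀ + zetaWedgeG J (u n) B + zetaBarWedgeG J (u n) C + frameLef J u {n} D - ε • frameLef J u S' D)
        (conjG (A₀ + zetaWedgeG J (u n) B + zetaBarWedgeG J (u n) C + frameLef J u {n} D - ε • frameLef J u S' D))) =
      (frameLef J u (insert n S') ^ r) (wedgeG A₀ (conjG A₀)) +
        frameLef J u {n} (((-1 : ℂ) ^ k₁ * (-2 * Complex.I)) • (frameLef J u S' ^ r) (wedgeG B (conjG B)) +
          ((-1 : ℂ) ^ k₁ * (2 * Complex.I)) • (frameLef J u S' ^ r) (wedgeG C (conjG C)) +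
          (ε ^ 2 * r - 2 * ε) • (frameLef J u S' ^ (r + 1)) (wedgeG D (conjG D))) := by
  classical
  -- notation
  set x := u n with hx
  set L : Module.End ℝ (GForm V ℂ) := frameLef J u (insert n S') with hL
  set L' : Module.End ℝ (GForm V ℂ) := frameLef J u S' with hL'
  set Ln : Module.End ℝ (GForm V ℂ) := frameLef J u {n} with hLn
  set θx : V →L[ℝ] ℝ := innerSL ℝ x
  set θy : V →L[ℝ] ℝ := innerSL ℝ (J x)
  -- primitivity in both slots of a wedge, for the powers we need
  have hA0' : ∀ j : ℕ, r ≤ j → (L' ^ j) A₀ = 0 := fun j hj ↦ by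
    obtain ⟨i, rfl⟩ := Nat.exists_eq_add_of_le hj
    rw [add_comm, pow_add, Module.End.mul_apply, hA0, LinearMap.map_zero]
  have hB' : ∀ j : ℕ, r + 1 ≤ j → (L' ^ j) B = 0 := fun j hj ↦ by
    obtain ⟨i, rfl⟩ := Nat.exists_eq_add_of_le hj
    rw [add_comm, pow_add, Module.End.mul_apply, hB, LinearMap.map_zero]
  have hC' : ∀ j : ℕ, r + 1 ≤ j → (L' ^ j) C = 0 := fun j hj ↦ by
    obtain ⟨i, rfl⟩ := Nat.exists_eq_add_of_le hj
    rw [add_comm, pow_add, Module.End.mul_apply, hC, LinearMap.map_zero]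
  have hD' : ∀ j : ℕ, r + 2 ≤ j → (L' ^ j) D = 0 := fun j hj ↦ by
    obtain ⟨i, rfl⟩ := Nat.exists_eq_add_of_le hj
    rw [add_comm, pow_add, Module.End.mul_apply, hD, LinearMap.map_zero]
  have conjB : conjG ((L' ^ (r + 1)) B) = 0 := by rw [hB, conjG_zero]
  -- pushing `L'^j` into a slot
  have pushL : ∀ (j : ℕ) (X Y : GForm V ℂ), (L' ^ j) (wedgeG X Y) = wedgeG ((L' ^ j) X) Y :=
    fun j X Y ↦ (wedgeG_lefG_pow_left _ _ S' j X Y).symm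
  have pushR : ∀ (j : ℕ) (X Y : GForm V ℂ), (L' ^ j) (wedgeG X Y) = wedgeG X ((L' ^ j) Y) :=
    fun j X Y ↦ (wedgeG_lefG_pow_right _ _ S' j X Y).symm
  have conjL : ∀ (j : ℕ) (X : GForm V ℂ), conjG ((L' ^ j) X) = (L' ^ j) (conjG X) :=
    fun j X ↦ conjG_lefG_pow _ _ S' j X
  -- the operator identities
  have O1 : ∀ Y, (L ^ r) (Ln Y) = Ln ((L' ^ r) Y) := frameLef_insert_pow_frameLef_singleton hn r
  have O2x : ∀ Y, (L ^ r) (wedgeOneG θx Y) = wedgeOneG θx ((L' ^ r) Y) := frameLef_insert_pow_wedgeOneG_u hn r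
  have O2y : ∀ Y, (L ^ r) (wedgeOneG θy Y) = wedgeOneG θy ((L' ^ r) Y) := frameLef_insert_pow_wedgeOneG_Ju hn r
  have O2z : ∀ Y, (L ^ r) (zetaWedgeG J x Y) = zetaWedgeG J x ((L' ^ r) Y) := frameLef_insert_pow_zetaWedgeG hn r
  have O2zb : ∀ Y, (L ^ r) (zetaBarWedgeG J x Y) = zetaBarWedgeG J x ((L' ^ r) Y) :=
    frameLef_insert_pow_zetaBarWedgeG hn r
  have O3 : ∀ Y, (L ^ r) (L' Y) = (L' ^ (r + 1)) Y + r • Ln ((L' ^ r) Y) := frameLef_insert_pow_frameLef hn r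
  -- `Ln` kills `θx ∧`, `θy ∧`, `ζ ∧`, `ζ̄ ∧`, `Ln`
  have Lnx : ∀ Y, Ln (wedgeOneG θx Y) = 0 := fun Y ↦ lefG_singleton_wedgeOneG_fst _ _ n Y
  have Lny : ∀ Y, Ln (wedgeOneG θy Y) = 0 := fun Y ↦ lefG_singleton_wedgeOneG_snd _ _ n Y
  have Lnz : ∀ Y, Ln (zetaWedgeG J x Y) = 0 := frameLef_singleton_zetaWedgeG n
  have Lnzb : ∀ Y, Ln (zetaBarWedgeG J x Y) = 0 := frameLef_singleton_zetaBarWedgeG n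
  have LnLn : ∀ Y, Ln (Ln Y) = 0 := frameLef_singleton_frameLef_singleton n
  have Ln_apply : ∀ Y, Ln Y = wedgeOneG θx (wedgeOneG θy Y) := frameLef_singleton n
  -- conjugates of the pieces
  have cζB : conjG (zetaWedgeG J x B) = zetaBarWedgeG J x (conjG B) := conjG_zetaWedgeG J x B
  have cζC : conjG (zetaBarWedgeG J x C) = zetaWedgeG J x (conjG C) := conjG_zetaBarWedgeG J x C
  have cLnD : conjG (Ln D) = Ln (conjG D) := conjG_lefG _ _ {n} D
  have cL' : ∀ X, conjG (L' X) = L' (conjG X) := fun X ↦ conjG_lefG _ _ S' X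
  have cL'D : conjG (ε • L' D) = ε • L' (conjG D) := by rw [conjG_smul_real, cL']
  -- wedges against `ζ ∧ Z`, `ζ̄ ∧ Z`, `Ln Z`, `L' Z` on the right and on the left
  have wζR : ∀ X Z, wedgeG X (zetaWedgeG J x Z) = zetaWedgeG J x (wedgeG (negDeg X) Z) := by
    intro X Z
    rw [zetaWedgeG_def, zetaWedgeG_def, wedgeG_add_right, wedgeG_smul_right_complex, wedgeG_wedgeOneG_right,
      wedgeG_wedgeOneG_right]
  have wζbR : ∀ X Z, wedgeG X (zetaBarWedgeG J x Z) = zetaBarWedgeG J x (wedgeG (negDeg X) Z) := by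
    intro X Z
    rw [zetaBarWedgeG_def, zetaBarWedgeG_def, wedgeG_sub_right, wedgeG_smul_right_complex, wedgeG_wedgeOneG_right,
      wedgeG_wedgeOneG_right]
  have wζL : ∀ X Z, wedgeG (zetaWedgeG J x X) Z = zetaWedgeG J x (wedgeG X Z) := by
    intro X Z
    rw [zetaWedgeG_def, zetaWedgeG_def, wedgeG_add_left, wedgeG_smul_left_complex, wedgeG_wedgeOneG_left,
      wedgeG_wedgeOneG_left]
  have wζbL : ∀ X Z, wedgeG (zetaBarWedgeG J x X) Z = zetaBarWedgeG J x (wedgeG X Z) := by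
    intro X Z
    rw [zetaBarWedgeG_def, zetaBarWedgeG_def, wedgeG_sub_left, wedgeG_smul_left_complex, wedgeG_wedgeOneG_left,
      wedgeG_wedgeOneG_left]
  have wLnR : ∀ X Z, wedgeG X (Ln Z) = Ln (wedgeG X Z) := fun X Z ↦ wedgeG_lefG_right _ _ {n} X Z
  have wLnL : ∀ X Z, wedgeG (Ln X) Z = Ln (wedgeG X Z) := fun X Z ↦ wedgeG_lefG_left _ _ {n} X Z
  have wL'R : ∀ X Z, wedgeG X (L' Z) = L' (wedgeG X Z) := fun X Z ↦ wedgeG_lefG_right _ _ S' X Z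
  have wL'L : ∀ X Z, wedgeG (L' X) Z = L' (wedgeG X Z) := fun X Z ↦ wedgeG_lefG_left _ _ S' X Z
  have L'pow1 : ∀ Y, L' Y = (L' ^ 1) Y := fun Y ↦ by rw [pow_one]
  have Lpow_succ : ∀ (j : ℕ) Y, (L' ^ j) (L' Y) = (L' ^ (j + 1)) Y := fun j Y ↦ by
    rw [pow_succ, Module.End.mul_apply]
  -- ζ and L' commute, Ln and L' commute, Ln and ζ commute
  have ζL' : ∀ (j : ℕ) Y, (L' ^ j) (zetaWedgeG J x Y) = zetaWedgeG J x ((L' ^ j) Y) :=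
    fun j Y ↦ frameLef_pow_zetaWedgeG S' j x Y
  have ζbL' : ∀ (j : ℕ) Y, (L' ^ j) (zetaBarWedgeG J x Y) = zetaBarWedgeG J x ((L' ^ j) Y) :=
    fun j Y ↦ frameLef_pow_zetaBarWedgeG S' j x Y
  have LnL' : ∀ (j : ℕ) Y, (L' ^ j) (Ln Y) = Ln ((L' ^ j) Y) := fun j Y ↦ frameLef_pow_frameLef S' {n} j Y
  have ζLn : ∀ Y, zetaWedgeG J x (Ln Y) = Ln (zetaWedgeG J x Y) := fun Y ↦ by
    have := frameLef_pow_zetaWedgeG (J := J) (u := u) {n} 1 x Y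
    rw [pow_one] at this
    exact this.symm
  have ζbLn : ∀ Y, zetaBarWedgeG J x (Ln Y) = Ln (zetaBarWedgeG J x Y) := fun Y ↦ by
    have := frameLef_pow_zetaBarWedgeG (J := J) (u := u) {n} 1 x Y
    rw [pow_one] at this
    exact this.symm
  -- `negDeg` commutes with `L'^j`; `negDeg` of the homogeneous `B`, `C`
  have nL' : ∀ (j : ℕ) Y, (L' ^ j) (negDeg Y) = negDeg ((L' ^ j) Y) := fun j Y ↦ lefG_pow_negDeg _ _ S' j Y
  have nB : negDeg B = ((-1 : ℂ) ^ k₁) • B := by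
    rw [hBh.eq_of, negDeg_of, ← coe_real_smul]; push_cast; rfl
  have nC : negDeg C = ((-1 : ℂ) ^ k₁) • C := by
    rw [hCh.eq_of, negDeg_of, ← coe_real_smul]; push_cast; rfl
  ------------------------------------------------------------------
  -- the sixteen + eight terms
  ------------------------------------------------------------------
  set Ab := conjG A₀ with hAb
  set Bb := conjG B with hBb
  set Cb := conjG C with hCb
  set Db := conjG D with hDb
  have LAb : ∀ j : ℕ, r ≤ j → (L' ^ j) Ab = 0 := fun j hj ↦ by rw [hAb, ← conjL, hA0' j hj, conjG_zero]
  have LBb : (L' ^ (r + 1)) Bb = 0 := by rw [hBb, ← conjL, hB, conjG_zero]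
  have LCb : (L' ^ (r + 1)) Cb = 0 := by rw [hCb, ← conjL, hC, conjG_zero]
  -- A₀ against the four pieces of `β̄`
  have t01 : (L ^ r) (wedgeG A₀ (zetaBarWedgeG J x Bb)) = 0 := by
    rw [wζbR, O2zb, pushL, nL', hA0, negDeg_zero, wedgeG_zero_left, zetaBarWedgeG_zero]
  have t02 : (L ^ r) (wedgeG A₀ (zetaWedgeG J x Cb)) = 0 := by
    rw [wζR, O2z, pushL, nL', hA0, negDeg_zero, wedgeG_zero_left, zetaWedgeG_zero]
  have t03 : (L ^ r) (wedgeG A₀ (Ln Db)) = 0 := by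
    rw [wLnR, O1, pushL, hA0, wedgeG_zero_left, LinearMap.map_zero]
  have t04 : (L ^ r) (wedgeG A₀ (ε • L' Db)) = 0 := by
    rw [wedgeG_smul_right, wL'R, map_smul, O3, pushL, hA0' (r + 1) (Nat.le_succ r), pushL, hA0, wedgeG_zero_left,
      LinearMap.map_zero, smul_zero, add_zero, smul_zero]
  -- `ζ ∧ B` against `Ā₀` and the four pieces
  have t10 : (L ^ r) (wedgeG (zetaWedgeG J x B) Ab) = 0 := by
    rw [wζL, O2z, pushR, LAb r le_rfl, wedgeG_zero_right, zetaWedgeG_zero]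
  have t11 : (L ^ r) (wedgeG (zetaWedgeG J x B) (zetaBarWedgeG J x Bb)) =
      Ln (((-1 : ℂ) ^ k₁ * (-2 * Complex.I)) • (L' ^ r) (wedgeG B Bb)) := by
    rw [wζL, wζbR, nB, wedgeG_smul_left_complex, zetaBarWedgeG_smul, zetaWedgeG_smul, zetaWedgeG_zetaBarWedgeG,
      ← Ln_apply, smul_smul, frameLef_pow_smul_complex, O1, frameLef_smul_complex]
  have t12 : (L ^ r) (wedgeG (zetaWedgeG J x B) (zetaWedgeG J x Cb)) = 0 := by
    rw [wζL, wζR, zetaWedgeG_zetaWedgeG, LinearMap.map_zero]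
  have t13 : (L ^ r) (wedgeG (zetaWedgeG J x B) (Ln Db)) = 0 := by
    rw [wζL, wLnR, ζLn, Lnz, LinearMap.map_zero]
  have t14 : (L ^ r) (wedgeG (zetaWedgeG J x B) (ε • L' Db)) = 0 := by
    rw [wedgeG_smul_right, map_smul, wζL, wL'R, O2z, Lpow_succ, pushL, hB, wedgeG_zero_left, zetaWedgeG_zero,
      smul_zero]
  -- `ζ̄ ∧ C` against `Ā₀` and the four pieces
  have t20 : (L ^ r) (wedgeG (zetaBarWedgeG J x C) Ab) = 0 := by
    rw [wζbL, O2zb, pushR, LAb r le_rfl, wedgeG_zero_right, zetaBarWedgeG_zero]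
  have t21 : (L ^ r) (wedgeG (zetaBarWedgeG J x C) (zetaBarWedgeG J x Bb)) = 0 := by
    rw [wζbL, wζbR, zetaBarWedgeG_zetaBarWedgeG, LinearMap.map_zero]
  have t22 : (L ^ r) (wedgeG (zetaBarWedgeG J x C) (zetaWedgeG J x Cb)) =
      Ln (((-1 : ℂ) ^ k₁ * (2 * Complex.I)) • (L' ^ r) (wedgeG C Cb)) := by
    rw [wζbL, wζR, nC, wedgeG_smul_left_complex, zetaWedgeG_smul, zetaBarWedgeG_smul, zetaBarWedgeG_zetaWedgeG,
      ← Ln_apply, smul_smul, frameLef_pow_smul_complex, O1, frameLef_smul_complex]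
  have t23 : (L ^ r) (wedgeG (zetaBarWedgeG J x C) (Ln Db)) = 0 := by
    rw [wζbL, wLnR, ζbLn, Lnzb, LinearMap.map_zero]
  have t24 : (L ^ r) (wedgeG (zetaBarWedgeG J x C) (ε • L' Db)) = 0 := by
    rw [wedgeG_smul_right, map_smul, wζbL, wL'R, O2zb, Lpow_succ, pushL, hC, wedgeG_zero_left,
      zetaBarWedgeG_zero, smul_zero]
  -- `Ln D` against `Ā₀` and the four pieces
  have t30 : (L ^ r) (wedgeG (Ln D) Ab) = 0 := by
    rw [wLnL, O1, pushR, LAb r le_rfl, wedgeG_zero_right, LinearMap.map_zero]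
  have t31 : (L ^ r) (wedgeG (Ln D) (zetaBarWedgeG J x Bb)) = 0 := by
    rw [wLnL, wζbR, Lnzb, LinearMap.map_zero]
  have t32 : (L ^ r) (wedgeG (Ln D) (zetaWedgeG J x Cb)) = 0 := by
    rw [wLnL, wζR, Lnz, LinearMap.map_zero]
  have t33 : (L ^ r) (wedgeG (Ln D) (Ln Db)) = 0 := by
    rw [wLnL, wLnR, LnLn, LinearMap.map_zero]
  have t34 : (L ^ r) (wedgeG (Ln D) (ε • L' Db)) = ε • Ln ((L' ^ (r + 1)) (wedgeG D Db)) := by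
    rw [wedgeG_smul_right, map_smul, wLnL, wL'R, O1, Lpow_succ]
  -- `ε L' D` against `Ā₀` and the four pieces
  have t40 : (L ^ r) (wedgeG (ε • L' D) Ab) = 0 := by
    rw [wedgeG_smul_left, map_smul, wL'L, O3, pushR, LAb (r + 1) (Nat.le_succ r), pushR, LAb r le_rfl,
      wedgeG_zero_right, LinearMap.map_zero, smul_zero, add_zero, smul_zero]
  have t41 : (L ^ r) (wedgeG (ε • L' D) (zetaBarWedgeG J x Bb)) = 0 := by
    rw [wedgeG_smul_left, map_smul, wL'L, O3, wζbR, ζbL', pushR, LBb, wedgeG_zero_right, zetaBarWedgeG_zero,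
      ζbL', Lnzb, smul_zero, add_zero, smul_zero]
  have t42 : (L ^ r) (wedgeG (ε • L' D) (zetaWedgeG J x Cb)) = 0 := by
    rw [wedgeG_smul_left, map_smul, wL'L, O3, wζR, ζL', pushR, LCb, wedgeG_zero_right, zetaWedgeG_zero,
      ζL', Lnz, smul_zero, add_zero, smul_zero]
  have t43 : (L ^ r) (wedgeG (ε • L' D) (Ln Db)) = ε • Ln ((L' ^ (r + 1)) (wedgeG D Db)) := by
    rw [wedgeG_smul_left, map_smul, wL'L, wLnR, O3, LnL', LnL', LnLn, smul_zero, add_zero]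
  have t44 : (L ^ r) (wedgeG (ε • L' D) (ε • L' Db)) = (ε * ε * r) • Ln ((L' ^ (r + 1)) (wedgeG D Db)) := by
    rw [wedgeG_smul_left, wedgeG_smul_right, map_smul, map_smul, wL'L, wL'R, O3, Lpow_succ, Lpow_succ, pushL,
      hD, wedgeG_zero_left, zero_add, smul_smul, ← Nat.cast_smul_eq_nsmul ℝ r, smul_smul]
  ------------------------------------------------------------------
  -- assembly
  ------------------------------------------------------------------
  have expand : ∀ (P₀ P₁ P₂ P₃ P₄ Q₀ Q₁ Q₂ Q₃ Q₄ : GForm V ℂ),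
      wedgeG (P₀ + P₁ + P₂ + P₃ - P₄) (Q₀ + Q₁ + Q₂ + Q₃ - Q₄) =
        wedgeG P₀ Q₀ + wedgeG P₀ Q₁ + wedgeG P₀ Q₂ + wedgeG P₀ Q₃ - wedgeG P₀ Q₄ +
        (wedgeG P₁ Q₀ + wedgeG P₁ Q₁ + wedgeG P₁ Q₂ + wedgeG P₁ Q₃ - wedgeG P₁ Q₄) +
        (wedgeG P₂ Q₀ + wedgeG P₂ Q₁ + wedgeG P₂ Q₂ + wedgeG P₂ Q₃ - wedgeG P₂ Q₄) +
        (wedgeG P₃ Q₀ + wedgeG P₃ Q₁ + wedgeG P₃ Q₂ + wedgeG P₃ Q₃ - wedgeG P₃ Q₄) -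
        (wedgeG P₄ Q₀ + wedgeG P₄ Q₁ + wedgeG P₄ Q₂ + wedgeG P₄ Q₃ - wedgeG P₄ Q₄) := by
    intro P₀ P₁ P₂ P₃ P₄ Q₀ Q₁ Q₂ Q₃ Q₄
    simp only [wedgeG_add_left, wedgeG_sub_left, wedgeG_add_right, wedgeG_sub_right]
    abel
  rw [conjG_sub, conjG_add, conjG_add, conjG_add, cζB, cζC, cLnD, cL'D, expand]
  simp only [_root_.map_add, _root_.map_sub]
  rw [t01, t02, t03, t04, t10, t11, t12, t13, t14, t20, t21, t22, t23, t24, t30, t31, t32, t33, t34, t40, t41, t42,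
    t43, t44]
  have eLn : ∀ (c : ℂ) (X : GForm V ℂ), Ln (c • X) = c • Ln X := fun c X ↦ frameLef_smul_complex {n} c X
  rw [eLn, eLn, _root_.map_smul, ← coe_real_smul ε, ← coe_real_smul (ε * ε * r),
    ← coe_real_smul (ε ^ 2 * r - 2 * ε)]
  push_cast
  module

end Identity

/-! ### Scalar bookkeeping for the induction step -/

/-- `ε_k² = 1`. [folklore] -/
theorem neg_one_pow_half_mul_self (k : ℕ) :
    (-1 : ℂ) ^ (k * (k - 1) / 2) * (-1 : ℂ) ^ (k * (k - 1) / 2) = 1 := by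
  rw [← pow_add, ← two_mul, pow_mul, neg_one_sq, one_pow]

/-- `ε_{k+1} (-1)^k = ε_k`. [folklore] -/
theorem neg_one_pow_half_succ_mul_neg_one_pow (k : ℕ) :
    (-1 : ℂ) ^ ((k + 1) * (k + 1 - 1) / 2) * (-1 : ℂ) ^ k = (-1 : ℂ) ^ (k * (k - 1) / 2) := by
  have h1 := neg_one_pow_half_succ_mul k
  have h2 := neg_one_pow_half_mul_self k
  have hm : (-1 : ℂ) ^ k * (-1 : ℂ) ^ k = 1 := by rw [← pow_add, ← two_mul, pow_mul, neg_one_sq, one_pow]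
  linear_combination ((-1 : ℂ) ^ k * (-1 : ℂ) ^ (k * (k - 1) / 2)) * h1 -
    ((-1 : ℂ) ^ k * (-1 : ℂ) ^ ((k + 1) * (k + 1 - 1) / 2)) * h2 + (-1 : ℂ) ^ (k * (k - 1) / 2) * hm

/-- The `b`-coefficient: `(i^w ε_{k+1}) ((-1)^k (-2i)) = 2 (i^{w-1} ε_k)`. [folklore] -/
theorem scalar_b (k : ℕ) (w : ℤ) :
    Complex.I ^ w * (-1 : ℂ) ^ ((k + 1) * (k + 1 - 1) / 2) * ((-1 : ℂ) ^ k * (-2 * Complex.I)) =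
      2 * (Complex.I ^ (w - 1) * (-1 : ℂ) ^ (k * (k - 1) / 2)) := by
  have h3 := neg_one_pow_half_succ_mul_neg_one_pow k
  have hI : Complex.I ^ (w - 1) = Complex.I ^ w * (-Complex.I) := by
    rw [zpow_sub_one₀ Complex.I_ne_zero, Complex.inv_I]
  rw [hI]
  linear_combination (Complex.I ^ w * (-2 * Complex.I)) * h3

/-- The `c`-coefficient: `(i^w ε_{k+1}) ((-1)^k (2i)) = 2 (i^{w+1} ε_k)`. [folklore] -/
theorem scalar_c (k : ℕ) (w : ℤ) :
    Complex.I ^ w * (-1 : ℂ) ^ ((k + 1) * (k + 1 - 1) / 2) * ((-1 : ℂ) ^ k * (2 * Complex.I)) =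
      2 * (Complex.I ^ (w + 1) * (-1 : ℂ) ^ (k * (k - 1) / 2)) := by
  have h3 := neg_one_pow_half_succ_mul_neg_one_pow k
  have hI : Complex.I ^ (w + 1) = Complex.I ^ w * Complex.I := zpow_add_one₀ Complex.I_ne_zero w
  rw [hI]
  linear_combination (Complex.I ^ w * (2 * Complex.I)) * h3

/-- The `d`-coefficient: `i^w ε_{k+2} = -(i^w ε_k)`. [folklore] -/
theorem scalar_d (k : ℕ) (w : ℤ) :
    Complex.I ^ w * (-1 : ℂ) ^ ((k + 1 + 1) * (k + 1 + 1 - 1) / 2) = -(Complex.I ^ w * (-1 : ℂ) ^ (k * (k - 1) / 2)) := by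
  have h1 := neg_one_pow_half_succ_succ_mul k
  have h2 := neg_one_pow_half_mul_self k
  have h3 : (-1 : ℂ) ^ ((k + 1 + 1) * (k + 1 + 1 - 1) / 2) = -(-1 : ℂ) ^ (k * (k - 1) / 2) := by
    change (-1 : ℂ) ^ ((k + 2) * (k + 2 - 1) / 2) = _
    linear_combination (-1 : ℂ) ^ (k * (k - 1) / 2) * h1 - (-1 : ℂ) ^ ((k + 2) * (k + 2 - 1) / 2) * h2
  rw [h3, mul_neg]

/-- `L_S^j` enters the left slot of a wedge. [folklore] -/
theorem frameLef_pow_wedgeG_left (S : Finset (Fin d)) (j : ℕ) (X Y : GForm V ℂ) :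
    (frameLef J u S ^ j) (wedgeG X Y) = wedgeG ((frameLef J u S ^ j) X) Y :=
  (wedgeG_lefG_pow_left _ _ S j X Y).symm

/-! ### Small facts for the induction step -/

/-- The unit graded form is supported everywhere. [folklore] -/
theorem isFrameSupported_one (S : Finset (Fin d)) :
    IsFrameSupported J u S (of 0 (constOfIsEmpty ℝ V (Fin 0) (1 : ℂ))) := fun _ _ ↦
  ⟨curryLeftG_of_zero _ _, curryLeftG_of_zero _ _⟩

/-- `L_T D` is homogeneous of degree `k₁ + 1` for the `d`-component of a form of degree `k₁ + 1`.
[folklore] -/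
theorem isHomog_frameLef_compD : ∀ {k₁ : ℕ} {α : GForm V ℂ}, IsHomog (k₁ + 1) α → ∀ (x : V) (T : Finset (Fin d)),
    IsHomog (k₁ + 1) (frameLef J u T (compD J x α))
  | 0, _, h, x, T => by rw [compD_eq_zero_of_isHomog_one h, LinearMap.map_zero]; exact IsHomog.zero 1
  | _ + 1, _, h, x, T => (isHomog_compD h x).lefG _ _ T

/-- Supports are stable under `L_T`, `T ⊆ S`. [folklore] -/
theorem IsFrameSupported.frameLef' {S T : Finset (Fin d)} {w : GForm V ℂ} (h : IsFrameSupported J u S w)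
    (hJJ : ∀ v, J (J v) = -v) (hJ : ∀ v w, ⟪J v, J w⟫_ℝ = ⟪v, w⟫_ℝ) (hu : Orthonormal ℝ u)
    (huJ : ∀ i j, ⟪u i, J (u j)⟫_ℝ = 0) (hTS : T ⊆ S) :
    IsFrameSupported J u S (Literature.Geometry.Kaehler.frameLef J u T w) :=
  h.lefG_coframe hJJ hJ hu huJ hTS

/-- Supports are stable under `L_T^r`, `T ⊆ S`. [folklore] -/
theorem IsFrameSupported.frameLef_pow' {S T : Finset (Fin d)} {w : GForm V ℂ} (h : IsFrameSupported J u S w)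
    (hJJ : ∀ v, J (J v) = -v) (hJ : ∀ v w, ⟪J v, J w⟫_ℝ = ⟪v, w⟫_ℝ) (hu : Orthonormal ℝ u)
    (huJ : ∀ i j, ⟪u i, J (u j)⟫_ℝ = 0) (hTS : T ⊆ S) (r : ℕ) :
    IsFrameSupported J u S ((Literature.Geometry.Kaehler.frameLef J u T ^ r) w) :=
  h.lefG_pow_coframe hJJ hJ hu huJ hTS r

/-! ### The induction -/

include hJJ hJ hu huJ in
set_option maxHeartbeats 4000000 in
/-- **The pointwise Hodge–Riemann bilinear relation on a unitary frame, by induction on the frame.**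
For `S ⊆ Fin d`, `L = L_S = ω_S ∧ ·`, and a `ℂ`-valued graded form `α` which is homogeneous of
degree `k`, supported in `S`, of weight `w` (type `(p,q)`, `p - q = w`) and `L`-primitive
(`L^{r+1} α = 0` with `k + r = |S|`):

  `i^w (-1)^{k(k-1)/2} L^r (α ∧ ᾱ) = c · L^{|S|} 1`  with `c ≥ 0`, and `c > 0` if `α ≠ 0`.

Proof: `|S| = 0` forces `k = 0` (degree zero, `hodgeRiemann_degree_zero`); for `S = insert n S'`
split `α` along `u_n` (file II), use `lef_pow_wedgeG_conjG_decomposition` and the induction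
hypothesis for `b, c` (degree `k-1`, weights `w ∓ 1`), `a₀` (degree `k`, `r-1`) and `d`
(degree `k-2`, `r+1`), whose coefficients `2, 2, r, (r+2)/(r+1)²` are non-negative.
[cite: Huybrechts2005, Cor. 1.2.36] [cite: Voisin2002, Thm. 6.32] -/
theorem hodgeRiemann_frame_induction [FiniteDimensional ℝ V] (hd : finrank ℝ V = 2 * d)
    (S : Finset (Fin d)) :
    ∀ (k r : ℕ) (w : ℤ) (α : GForm V ℂ), IsHomog k α → IsFrameSupported J u S α → HasRotWeight J w α →
      k + r = S.card → (frameLef J u S ^ (r + 1)) α = 0 →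
      ∃ c : ℝ, 0 ≤ c ∧ (α ≠ 0 → 0 < c) ∧
        (Complex.I ^ w * (-1 : ℂ) ^ (k * (k - 1) / 2)) • (frameLef J u S ^ r) (wedgeG α (conjG α)) =
          (c : ℂ) • (frameLef J u S ^ S.card) (of 0 (constOfIsEmpty ℝ V (Fin 0) (1 : ℂ))) := by
  classical
  induction S using Finset.induction_on with
  | empty =>
    intro k r w α hk _ hw hkr _
    rw [Finset.card_empty] at hkr ⊢
    obtain ⟨rfl, rfl⟩ : k = 0 ∧ r = 0 := ⟨by omega, by omega⟩
    exact hodgeRiemann_degree_zero J _ _ ∅ 0 hk hw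
  | insert n S' hn IH =>
    intro k r w α hk hS hw hkr hprim
    rw [Finset.card_insert_of_notMem hn] at hkr ⊢
    cases k with
    | zero =>
      obtain rfl : r = S'.card + 1 := by omega
      exact hodgeRiemann_degree_zero J _ _ _ _ hk hw
    | succ k₁ =>
    -- notation
    set x := u n with hxdef
    set L : Module.End ℝ (GForm V ℂ) := frameLef J u (insert n S') with hL
    set L' : Module.End ℝ (GForm V ℂ) := frameLef J u S' with hL'
    set Ln : Module.End ℝ (GForm V ℂ) := frameLef J u {n} with hLn
    set one : GForm V ℂ := of 0 (constOfIsEmpty ℝ V (Fin 0) (1 : ℂ)) with hone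
    set Ω' : GForm V ℂ := (L' ^ S'.card) one with hΩ'
    set A := compA J x α with hA
    set B := compB J x α with hB
    set C := compC J x α with hC
    set D := compD J x α with hD
    set ε : ℝ := ((r + 1 : ℕ) : ℝ)⁻¹ with hε
    set A₀ : GForm V ℂ := A + ε • L' D with hA₀
    have hkr' : k₁ + r = S'.card := by omega
    have hnS : n ∈ insert n S' := Finset.mem_insert_self n S'
    -- degrees
    have hBh : IsHomog k₁ B := isHomog_compB hk x
    have hCh : IsHomog k₁ C := isHomog_compC hk x
    have hAh : IsHomog (k₁ + 1) A := isHomog_compA hk x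
    have hLDh : IsHomog (k₁ + 1) (L' D) := isHomog_frameLef_compD J u hk x S'
    have hA0h : IsHomog (k₁ + 1) A₀ := hAh.add (hLDh.smul _)
    -- supports (in `S'`, as `(insert n S').erase n = S'`)
    have hers : (insert n S').erase n = S' := Finset.erase_insert hn
    have hBs : IsFrameSupported J u S' B := by
      have := isFrameSupported_compB_erase hJJ hJ hu huJ hnS hS; rwa [hers] at this
    have hCs : IsFrameSupported J u S' C := by
      have := isFrameSupported_compC_erase hJJ hJ hu huJ hnS hS; rwa [hers] at this
    have hAs : IsFrameSupported J u S' A := by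
      have := isFrameSupported_compA_erase hJJ hJ hu huJ hnS hS; rwa [hers] at this
    have hDs : IsFrameSupported J u S' D := by
      have := isFrameSupported_compD_erase hS n; rwa [hers] at this
    have hA0s : IsFrameSupported J u S' A₀ := hAs.add ((hDs.frameLef' J u hJJ hJ hu huJ subset_rfl).smul _)
    -- weights
    have hBw : HasRotWeight J (w - 1) B := hasRotWeight_compB hJJ hJ hw x
    have hCw : HasRotWeight J (w + 1) C := hasRotWeight_compC hJJ hJ hw x
    have hAw : HasRotWeight J w A := hasRotWeight_compA hJJ hJ hw x
    have hDw : HasRotWeight J w D := hasRotWeight_compD hJJ hw x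
    have hA0w : HasRotWeight J w A₀ := hAw.add ((hDw.frameLef J hJJ hJ u S').smul_real _)
    -- primitivity
    obtain ⟨hBp, hCp, -, -⟩ := primitive_components hJJ hJ hu huJ hn r α hprim
    obtain ⟨hA0p, hDp⟩ := primitive_compA₀ hJJ hJ hu huJ hn r α hprim
    change (L' ^ r) A₀ = 0 at hA0p
    -- the decomposition in the form of the identity
    have hdec : α = A₀ + zetaWedgeG J x B + zetaBarWedgeG J x C + Ln D - ε • L' D := by
      rw [decomposition_eq J x α, hA₀, ← frameLef_singleton n]
      abel
    -- the identity
    have hid := lef_pow_wedgeG_conjG_decomposition (J := J) (u := u) hn hBh hCh hA0p hBp hCp hDp ε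
    rw [← hdec] at hid
    -- the unit form: `L^{|S'|+1} 1 = (|S'|+1) Ln Ω'`
    have hone_s : IsFrameSupported J u S' one := isFrameSupported_one J u S'
    have hΩ : (L ^ (S'.card + 1)) one = (S'.card + 1) • Ln Ω' := by
      have hbin : (L ^ (S'.card + 1) : Module.End ℝ (GForm V ℂ)) =
          L' ^ (S'.card + 1) + (S'.card + 1) • (Ln * L' ^ S'.card) := lefG_insert_pow_succ _ _ hn _
      have hvan : (L' ^ (S'.card + 1)) one = 0 :=
        (hone_s.frameLef_pow' J u hJJ hJ hu huJ subset_rfl _).eq_zero_of_isHomog J hJJ hJ u hu huJ hd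
          ((IsHomog.of 0 _).lefG_pow _ _ S' _) (by omega)
      rw [hbin, LinearMap.add_apply, hvan, zero_add, LinearMap.smul_apply, Module.End.mul_apply]
    ------------------------------------------------------------------
    -- the four contributions
    ------------------------------------------------------------------
    set Φ : ℂ := Complex.I ^ w * (-1 : ℂ) ^ ((k₁ + 1) * (k₁ + 1 - 1) / 2) with hΦ
    -- (b)
    obtain ⟨cb, hcb0, hcbp, eb⟩ := IH k₁ r (w - 1) B hBh hBs hBw hkr' hBp
    have tb : Φ • Ln (((-1 : ℂ) ^ k₁ * (-2 * Complex.I)) • (L' ^ r) (wedgeG B (conjG B))) =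
        ((2 * cb : ℝ) : ℂ) • Ln Ω' := by
      rw [← frameLef_smul_complex, smul_smul, scalar_b, mul_smul, eb, smul_smul, frameLef_smul_complex]
      push_cast; ring_nf; try rfl
    -- (c)
    obtain ⟨cc, hcc0, hccp, ec⟩ := IH k₁ r (w + 1) C hCh hCs hCw hkr' hCp
    have tc : Φ • Ln (((-1 : ℂ) ^ k₁ * (2 * Complex.I)) • (L' ^ r) (wedgeG C (conjG C))) =
        ((2 * cc : ℝ) : ℂ) • Ln Ω' := by
      rw [← frameLef_smul_complex, smul_smul, scalar_c, mul_smul, ec, smul_smul, frameLef_smul_complex]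
      push_cast; ring_nf; try rfl
    -- (a₀): by cases on `r`
    have ta : ∃ ca : ℝ, 0 ≤ ca ∧ (A₀ ≠ 0 → 0 < ca) ∧
        Φ • (L ^ r) (wedgeG A₀ (conjG A₀)) = ((r * ca : ℝ) : ℂ) • Ln Ω' := by
      cases hr : r with
      | zero =>
        have hA00 : A₀ = 0 := by rw [hr, pow_zero, Module.End.one_apply] at hA0p; exact hA0p
        refine ⟨0, le_rfl, fun h ↦ absurd hA00 h, ?_⟩
        rw [hA00, wedgeG_zero_left, LinearMap.map_zero, smul_zero]
        push_cast
        rw [mul_zero, zero_smul]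
      | succ r' =>
        rw [hr] at hA0p hkr'
        obtain ⟨ca, hca0, hcap, ea⟩ := IH (k₁ + 1) r' w A₀ hA0h hA0s hA0w (by omega) hA0p
        refine ⟨ca, hca0, hcap, ?_⟩
        have hbin : (L ^ (r' + 1) : Module.End ℝ (GForm V ℂ)) = L' ^ (r' + 1) + (r' + 1) • (Ln * L' ^ r') :=
          lefG_insert_pow_succ _ _ hn r'
        have hvan : (L' ^ (r' + 1)) (wedgeG A₀ (conjG A₀)) = 0 := by
          rw [frameLef_pow_wedgeG_left, hA0p, wedgeG_zero_left]
        rw [hbin, LinearMap.add_apply, hvan, zero_add, LinearMap.smul_apply, Module.End.mul_apply, smul_comm,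
          ← frameLef_smul_complex, ea, frameLef_smul_complex, ← Nat.cast_smul_eq_nsmul ℂ, smul_smul]
        push_cast; ring_nf; try rfl
    obtain ⟨ca, hca0, hcap, ea⟩ := ta
    -- (d): by cases on `k₁`
    have td : ∃ cd : ℝ, 0 ≤ cd ∧ (D ≠ 0 → 0 < cd) ∧
        Φ • Ln ((ε ^ 2 * r - 2 * ε) • (L' ^ (r + 1)) (wedgeG D (conjG D))) =
          (((2 * ε - ε ^ 2 * r) * cd : ℝ) : ℂ) • Ln Ω' := by
      cases hk₁ : k₁ with
      | zero =>
        subst hk₁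
        have hD0 : D = 0 := compD_eq_zero_of_isHomog_one hk x
        refine ⟨0, le_rfl, fun h ↦ absurd hD0 h, ?_⟩
        rw [hD0, wedgeG_zero_left, LinearMap.map_zero, smul_zero, LinearMap.map_zero, smul_zero]
        push_cast
        rw [mul_zero, zero_smul]
      | succ k₂ =>
        subst hk₁
        have hDh : IsHomog k₂ D := isHomog_compD hk x
        obtain ⟨cd, hcd0, hcdp, ed⟩ := IH k₂ (r + 1) w D hDh hDs hDw (by omega) hDp
        refine ⟨cd, hcd0, hcdp, ?_⟩
        rw [map_smul, smul_comm, ← frameLef_smul_complex, hΦ, scalar_d k₂ w, neg_smul, ed, map_neg,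
          frameLef_smul_complex, smul_neg, ← coe_real_smul, smul_smul, ← neg_smul]
        push_cast; ring_nf; try rfl
    obtain ⟨cd, hcd0, hcdp, ed⟩ := td
    ------------------------------------------------------------------
    -- assembly
    ------------------------------------------------------------------
    have hεpos : 0 < ε := by rw [hε]; exact inv_pos.2 (by exact_mod_cast Nat.succ_pos r)
    have hcoef : 0 < 2 * ε - ε ^ 2 * r := by
      have hr1 : ε * (r + 1 : ℝ) = 1 := by
        rw [hε]; push_cast; exact inv_mul_cancel₀ (by exact_mod_cast (Nat.succ_ne_zero r))
      nlinarith [hεpos, hr1, sq_nonneg ε]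
    set TOTAL : ℝ := r * ca + 2 * cb + 2 * cc + (2 * ε - ε ^ 2 * r) * cd with hT
    have hrca : 0 ≤ (r : ℝ) * ca := mul_nonneg (Nat.cast_nonneg r) hca0
    have hdcd : 0 ≤ (2 * ε - ε ^ 2 * r) * cd := mul_nonneg hcoef.le hcd0
    have hT0 : 0 ≤ TOTAL := by rw [hT]; linarith
    have hmain : Φ • (L ^ r) (wedgeG α (conjG α)) = (TOTAL : ℂ) • Ln Ω' := by
      rw [hid, smul_add, ea, map_add, map_add, smul_add, smul_add, tb, tc, ed, hT]
      push_cast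
      module
    have hS1 : (0 : ℝ) < S'.card + 1 := Nat.cast_add_one_pos _
    refine ⟨TOTAL / (S'.card + 1), div_nonneg hT0 hS1.le, fun hα ↦ ?_, ?_⟩
    · -- positivity
      apply div_pos _ hS1
      rw [hT]
      by_cases hB0 : B = 0
      · by_cases hC0 : C = 0
        · by_cases hD0 : D = 0
          · -- then `α = A₀ ≠ 0`, so `r ≥ 1` and `ca > 0`
            have hαA : α = A₀ := by
              rw [hdec, hB0, hC0, hD0, zetaWedgeG_zero, zetaBarWedgeG_zero, LinearMap.map_zero, LinearMap.map_zero,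
                smul_zero, add_zero, add_zero, add_zero, sub_zero]
            have hA0ne : A₀ ≠ 0 := fun h ↦ hα (hαA.trans h)
            have hrpos : 0 < r := by
              rcases Nat.eq_zero_or_pos r with hr | hr
              · exfalso; apply hA0ne
                rw [hr, pow_zero, Module.End.one_apply] at hA0p; exact hA0p
              · exact hr
            have h1 : 0 < (r : ℝ) * ca := mul_pos (by exact_mod_cast hrpos) (hcap hA0ne)
            linarith
          · have h1 : 0 < (2 * ε - ε ^ 2 * r) * cd := mul_pos hcoef (hcdp hD0)
            linarith
        · have h1 : 0 < cc := hccp hC0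
          linarith
      · have h1 : 0 < cb := hcbp hB0
        linarith
    · -- the identity
      rw [hmain, hΩ, ← Nat.cast_smul_eq_nsmul ℂ, smul_smul]
      congr 1
      push_cast
      field_simp

end HodgeRiemann

/-! ### The full frame -/

section Full

variable {V : Type*} [NormedAddCommGroup V] [InnerProductSpace ℝ V] [FiniteDimensional ℝ V]
  (J : V →L[ℝ] V) (hJJ : ∀ v, J (J v) = -v) (hJ : ∀ v w, ⟪J v, J w⟫_ℝ = ⟪v, w⟫_ℝ)
  {d : ℕ} (u : Fin d → V) (hd : finrank ℝ V = 2 * d) (hu : Orthonormal ℝ u)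
  (huJ : ∀ i j, ⟪u i, J (u j)⟫_ℝ = 0)

include hJJ hJ hd hu huJ in
/-- **The pointwise Hodge–Riemann bilinear relation in CAR form** (Huybrechts (2005), Cor. 1.2.36;
Voisin (2002), Thm. 6.32 at a point). On a real inner product space of dimension `2d` with
isometric complex structure `J` and unitary frame `u`, let `L = ω ∧ · = ∑ₐ θₐ ∧ θ'ₐ ∧ ·` on graded
`ℂ`-valued forms. For a homogeneous `k`-form `α` of weight `w` (type `(p, q)`, `p - q = w`) with
`L^{r+1} α = 0`, `k + r = d`, there is `c ≥ 0`, positive if `α ≠ 0`, with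

  `i^w (-1)^{k(k-1)/2} L^r (α ∧ ᾱ) = c · L^d 1`.

[cite: Huybrechts2005, Cor. 1.2.36] [cite: Voisin2002, Thm. 6.32] -/
theorem hodgeRiemann_frame {k r : ℕ} {w : ℤ} {α : GForm V ℂ} (hk : IsHomog k α) (hw : HasRotWeight J w α)
    (hkr : k + r = d) (hprim : (frameLef J u Finset.univ ^ (r + 1)) α = 0) :
    ∃ c : ℝ, 0 ≤ c ∧ (α ≠ 0 → 0 < c) ∧
      (Complex.I ^ w * (-1 : ℂ) ^ (k * (k - 1) / 2)) • (frameLef J u Finset.univ ^ r) (wedgeG α (conjG α)) =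
        (c : ℂ) • (frameLef J u Finset.univ ^ d) (of 0 (constOfIsEmpty ℝ V (Fin 0) (1 : ℂ))) := by
  have h := hodgeRiemann_frame_induction J hJJ hJ u hu huJ hd Finset.univ k r w α hk (IsFrameSupported.univ α) hw
    (by rw [Finset.card_univ, Fintype.card_fin]; exact hkr) hprim
  rwa [Finset.card_univ, Fintype.card_fin] at h

end Full

end Literature.Geometry.Kaehler

end
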